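import Summits.BirchSwinnertonDyer.BirchSwinnertonDyer.Theorems.ManinLocalTwoThreeEtaIdentitiesSeventyTwo
import Summits.BirchSwinnertonDyer.BirchSwinnertonDyer.Theorems.ManinLocalTwoThreeNewformPinningSeventyTwo
import Summits.BirchSwinnertonDyer.BirchSwinnertonDyer.Theorems.ManinLocalTwoThreeNeronSqueeze
import Summits.BirchSwinnertonDyer.Rank1Residual.Additive.IntModelConductorCertificate
import HarnessLib

/-!
# `|c| = 1` on `X₀(72)` — UNCONDITIONALLY: the first genus-FIVE level, lying in BOTH crux domains (`2² ∣ 72`, `3² ∣ 72`);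
# `N(72a1) = 72` in the kernel; the domain is inhabited under the items' modularity binder

Cell bsd-f2-manin, route `ManinLocalTwoThree` (cruxes C2 `ManinOddAtFour` stmt-22967 AND C3 `ManinPrimeToThreeAtNine` stmt-22968),
prover seat p3 gen 24; the capstone of the level-`72` chain `EtaLogDerivativeForms → EulerRemaindersSeventyTwo → EtaQuotientsSeventyTwo
→ EtaLimitsSeventyTwo → LevelThirtySixFormsSeventyTwo → EtaIdentitiesSeventyTwo` (the "E₂ road": (I1) `y² = x³ + 6x − 7`, (I2a),
(I2b), (S2)₇₂ `Λ(φ₇₂) ⊆ Λ(−24, 28)`) joined with p2 g27's fact-free newform pinning `NewformSeventyTwo.f_apply_eq_phi72`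
(`⇑D.f = ⅔·η₄⁴η₆²/η₂² + ⅓·η₂⁴η₁₂²/η₄²` for EVERY `X₀(72)`-datum) and the general Néron squeeze
(`NeronSqueeze.abs_maninConstant_eq_one_of_periodLattice_le`) with `W₀ = 72a1 = [0, 0, 0, 6, −7]`.

* §1 `72a1 = [0, 0, 0, 6, −7]`: elliptic, globally minimal (`Δ = −2⁴3⁷`), **`N(72a1) = 72`** by the rank-2 observatory's kernel
  Tate certificates (type `III` at `2`: `(r, s, t) = (0, 0, 1)`, `v₂(b₈) = 2`, `f₂ = 3`; type `I₁*` at `3`: `(r, s, t) = (4, 0, 0)`,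
  exit `71` round `0`, `f₃ = 2`), Néron invariants `(c₄/12, c₆/216) = (−24, 28)`;
* §2 **`abs_maninConstant_eq_one_seventyTwo`: for every globally minimal elliptic `W/ℚ` and every `X₀(72)`-datum `D` of `W` with the
  lattice clause, `|D.maninConstant| = 1`**, hence **`2 ∤ c` AND `3 ∤ c`** — the bodies of C2 and C3 at `N = 72` with NONE of the
  items' hypotheses (no Mazur, Abbes–Ullmo, Česnavičius, modularity, CDT);
* §3 the `X₀(72)`-domain is inhabited GIVEN the items' own binder `exists_isNewformOf`, and the item-shaped statements
  `maninOddAtFour_seventyTwo`, `maninPrimeToThreeAtNine_seventyTwo`.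

HONEST FRAMING: unconditional (standard axioms) except §3's inhabitation (conditional on `exists_isNewformOf`, the items' binder).
The `∀ N` cruxes C2/C3, Manin's conjecture and BSD are NOT proved; items 22967/22968 stay OPEN as filed.  No definition, no named
fact, no sorry. [cite: AgasheRibetStein2006, §§1–2] [cite: CremonaAlgorithms1997, Table 1 (72a1)] [cite: Silverman1994, IV.9.4 and IV.11.1]
[cite: EdixhovenManin1991, Prop. 2] [cite: DiamondShurman2005, Thm. 8.8.3]
-/

set_option autoImplicit false
-- lint-debt: the directory name repeats the summit name (sibling precedent `ManinLocalTwoThreeNeronSqueezeSixtyFour.lean`)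
set_option linter.dupNamespace false

noncomputable section

open Complex Filter Topology Set Function
open UpperHalfPlane hiding I
open scoped Real Topology Manifold MatrixGroups ModularForm
open ModularForm CongruenceSubgroup WeierstrassCurve
open Summit.BirchSwinnertonDyer.BirchSwinnertonDyer.Rank2Observatory
open Summit.BirchSwinnertonDyer.BirchSwinnertonDyer.Rank2Observatory.RootNumber
open Summit.BirchSwinnertonDyer.BirchSwinnertonDyer.Rank2Observatory.Tate
open Summit.BirchSwinnertonDyer.Rank1Residual.Additive
open Literature.NumberTheory.EllipticCurves Literature.NumberTheory.EllipticCurves.ModularForms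
open Literature.NumberTheory.Automorphic

namespace Summit.BirchSwinnertonDyer.BirchSwinnertonDyer.Theorems.ManinLocalTwoThree.ManinConstantSeventyTwo

open EtaIdentitiesSeventyTwo NewformSeventyTwo

/-! ## §1 `72a1 = [0, 0, 0, 6, −7]`: elliptic, minimal, conductor `72`, Néron invariants `(−24, 28)` -/

/-- The literal `ℚ`-model `[0, 0, 0, 6, −7]` read through integer casts. [folklore] -/
theorem mk_seventyTwoA1_eq_cast :
    (⟨0, 0, 0, 6, -7⟩ : WeierstrassCurve ℚ) = ⟨((0 : ℤ) : ℚ), ((0 : ℤ) : ℚ), ((0 : ℤ) : ℚ), ((6 : ℤ) : ℚ), ((-7 : ℤ) : ℚ)⟩ := by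
  ext <;> norm_num

/-- `72a1 = [0, 0, 0, 6, −7]` is globally minimal (`Δ = −2⁴·3⁷`: `v₂(Δ) = 4 < 12`, `v₃(Δ) = 7 < 12`; kernel certificate).
[cite: SilvermanAEC2009, VII.1 Remark 1.1] -/
theorem isGloballyMinimal_seventyTwoA1 : (⟨0, 0, 0, 6, -7⟩ : WeierstrassCurve ℚ).IsGloballyMinimal := by
  rw [mk_seventyTwoA1_eq_cast]
  exact IntModelCond.isGloballyMinimal_mk_of_minCheck 0 0 0 6 (-7) (cm := ⟨4, 5, 5, [⟨3, 1, 7, 2, 2⟩]⟩) (by decide +kernel)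

/-- `[0, 0, 0, 6, −7]` is an elliptic curve (`Δ = −34992 ≠ 0`); a theorem, use `haveI`. [folklore] -/
theorem isElliptic_seventyTwoA1 : (⟨0, 0, 0, 6, -7⟩ : WeierstrassCurve ℚ).IsElliptic :=
  ⟨by norm_num [WeierstrassCurve.Δ, WeierstrassCurve.b₂, WeierstrassCurve.b₄, WeierstrassCurve.b₆, WeierstrassCurve.b₈]⟩

/-- **`N([0, 0, 0, 6, −7]) = 72 = 2³·3²`**: Step-4 Tate certificate at `2` (`(r, s, t) = (0, 0, 1)` to `[0, 0, 2, 6, −8]`, `4 ∣ a₆`,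
`2² ∥ b₈ = −36`: type `III`, `f₂ = 4 + 1 − 2 = 3`) and deep Tate certificate at `3` (`(r, s, t) = (4, 0, 0)` to `[0, 12, 0, 54, 81]`, exit
`I₁*`: `3 ∥ a₂`, `27 ∣ a₄`, `81 ∣ a₆`, `3 ∤ 4`; `f₃ = 7 + 1 − 6 = 2`), no other bad prime; all kernel-checked, minimality included.
[cite: Silverman1994, IV.9.4 and IV.11.1] [cite: CremonaAlgorithms1997, Table 1 (72a1)] -/
theorem conductorNorm_seventyTwoA1 : (⟨0, 0, 0, 6, -7⟩ : WeierstrassCurve ℚ).conductorNorm ℤ = 72 := by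
  rw [mk_seventyTwoA1_eq_cast]
  exact IntModelCond.conductorNorm_mk_eq_of_certs_of_eq 0 0 0 6 (-7)
    (cm := ⟨4, 5, 5, [⟨3, 1, 7, 2, 2⟩]⟩) (c := ⟨4, 5, 5, 7, 2, 3, []⟩)
    (l₂ := ⟨2, 0, 0, 1, 4, 3, 2⟩) (l₃ := ⟨3, 4, 0, 0, 7, 71, 0⟩)
    (by decide +kernel) (by decide +kernel) (by decide +kernel) (by decide +kernel) (by decide +kernel)

/-- **The Néron invariants of `72a1`**: `c₄ = −288`, `c₆ = 6048`, so `IsNeronLatticeOf (W₀/ℂ) L ⟺ (g₂(L), g₃(L)) = (−24, 28)`; here the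
direction used. [cite: CremonaAlgorithms1997, Table 1 (72a1)] -/
theorem isNeronLatticeOf_seventyTwoA1 {L₁ : PeriodPair} (hg2 : L₁.g₂ = -24) (hg3 : L₁.g₃ = 28) :
    IsNeronLatticeOf ((⟨0, 0, 0, 6, -7⟩ : WeierstrassCurve ℚ).baseChange ℂ) L₁ := by
  constructor
  · rw [hg2]
    norm_num [WeierstrassCurve.baseChange, WeierstrassCurve.map_c₄, WeierstrassCurve.c₄,
      WeierstrassCurve.b₂, WeierstrassCurve.b₄]
  · rw [hg3]
    norm_num [WeierstrassCurve.baseChange, WeierstrassCurve.map_c₆, WeierstrassCurve.c₆,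
      WeierstrassCurve.b₂, WeierstrassCurve.b₄, WeierstrassCurve.b₆]

/-! ## §2 The squeeze: `|c| = 1`, `2 ∤ c`, `3 ∤ c` on `X₀(72)`, unconditionally -/

/-- **`|c| = 1` for every `X₀(72)`-datum whose newform is `φ₇₂ = ⅔h₁ + ⅓h₂`** (pointwise): (S2)₇₂ + the general Néron squeeze with
`W₀ = 72a1`. [cite: AgasheRibetStein2006, §§1–2] -/
theorem abs_maninConstant_eq_one_seventyTwo_of_f_eq (W : WeierstrassCurve ℚ) [W.IsElliptic] [W.IsGloballyMinimal]
    (D : ModularParametrizationData W 72)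
    (hf : ⇑D.f = fun τ ↦ (2 / 3 : ℂ) * etaQuotient 72 (expFn [(2, -2), (4, 4), (6, 2)]) τ + (1 / 3 : ℂ) * etaQuotient 72 (expFn [(2, 4), (4, -2), (12, 2)]) τ)
    (hopt : ∀ z ∈ D.L.lattice, ∃ w ∈ periodLattice D.f, z = D.c * w) :
    |D.maninConstant| = 1 := by
  haveI := isElliptic_seventyTwoA1
  haveI := isGloballyMinimal_seventyTwoA1
  obtain ⟨L₁, hg2, hg3, hle⟩ := periodLatticeLe_seventyTwo D.f hf
  exact NeronSqueeze.abs_maninConstant_eq_one_of_periodLattice_le (⟨0, 0, 0, 6, -7⟩ : WeierstrassCurve ℚ) L₁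
    (isNeronLatticeOf_seventyTwoA1 hg2 hg3) W D hle hopt

/-- **`|c| = 1` on `X₀(72)`, UNCONDITIONALLY**: for every globally minimal elliptic `W/ℚ` and every `X₀(72)`-parametrisation datum `D`
of `W` with the lattice clause `Λ_W = c·Λ(D.f)` (`D.f = φ₇₂` by p2's fact-free pinning). [cite: AgasheRibetStein2006, §§1–2] -/
theorem abs_maninConstant_eq_one_seventyTwo (W : WeierstrassCurve ℚ) [W.IsElliptic] [W.IsGloballyMinimal]
    (D : ModularParametrizationData W 72)
    (hopt : ∀ z ∈ D.L.lattice, ∃ w ∈ periodLattice D.f, z = D.c * w) :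
    |D.maninConstant| = 1 :=
  abs_maninConstant_eq_one_seventyTwo_of_f_eq W D (f_apply_eq_phi72 D) hopt

/-- **`2 ∤ c` on `X₀(72)`, UNCONDITIONALLY** — the body of the crux C2 `ManinOddAtFour` at `N = 72` (`2² ∣ 72`) with none of its four
fact hypotheses. [cite: AgasheRibetStein2006, §§1–2] -/
theorem not_two_dvd_maninConstant_seventyTwo (W : WeierstrassCurve ℚ) [W.IsElliptic] [W.IsGloballyMinimal]
    (D : ModularParametrizationData W 72)
    (hopt : ∀ z ∈ D.L.lattice, ∃ w ∈ periodLattice D.f, z = D.c * w) :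
    ¬ (2 : ℤ) ∣ D.maninConstant := by
  have h := abs_maninConstant_eq_one_seventyTwo W D hopt
  intro h2
  have := Int.le_of_dvd (by rw [h]; norm_num) ((dvd_abs _ _).mpr h2)
  rw [h] at this
  norm_num at this

/-- **`3 ∤ c` on `X₀(72)`, UNCONDITIONALLY** — the body of the crux C3 `ManinPrimeToThreeAtNine` at `N = 72` (`3² ∣ 72`) with none of
its fact hypotheses. [cite: AgasheRibetStein2006, §§1–2] -/
theorem not_three_dvd_maninConstant_seventyTwo (W : WeierstrassCurve ℚ) [W.IsElliptic] [W.IsGloballyMinimal]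
    (D : ModularParametrizationData W 72)
    (hopt : ∀ z ∈ D.L.lattice, ∃ w ∈ periodLattice D.f, z = D.c * w) :
    ¬ (3 : ℤ) ∣ D.maninConstant := by
  have h := abs_maninConstant_eq_one_seventyTwo W D hopt
  intro h3
  have := Int.le_of_dvd (by rw [h]; norm_num) ((dvd_abs _ _).mpr h3)
  rw [h] at this
  norm_num at this

/-! ## §3 The `X₀(72)`-domain is inhabited GIVEN the items' binder `exists_isNewformOf`; the item-shaped statements -/

/-- **Modularity at `72a1`, levelled**: under `exists_isNewformOf` the curve `[0, 0, 0, 6, −7]` has a newform in `S₂(Γ₀(72))` (its conductor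
IS `72`).  CONDITIONAL on the items' own binder. [cite: DiamondShurman2005, Thm. 8.8.3] -/
theorem exists_isNewformOf_seventyTwoA1 (hnf : exists_isNewformOf) :
    ∃ f : CuspForm (Gamma0 72) 2, IsNewformOf (⟨0, 0, 0, 6, -7⟩ : WeierstrassCurve ℚ) f := by
  haveI := isElliptic_seventyTwoA1
  have key : ∀ (N : ℕ) [NeZero N], (⟨0, 0, 0, 6, -7⟩ : WeierstrassCurve ℚ).conductorNorm ℤ = N →
      ∃ f : CuspForm (Gamma0 N) 2, IsNewformOf (⟨0, 0, 0, 6, -7⟩ : WeierstrassCurve ℚ) f := by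
    intro N _ hN
    subst hN
    exact hnf _
  haveI : NeZero (72 : ℕ) := ⟨by decide⟩
  exact key 72 conductorNorm_seventyTwoA1

/-- **A lattice-optimal `X₀(72)`-datum on a globally minimal curve of the class `72a` exists under modularity**, and it has `|c| = 1`.
CONDITIONAL on `exists_isNewformOf` only. [cite: EdixhovenManin1991, Prop. 2] [cite: DiamondShurman2005, Thm. 8.8.3] -/
theorem domain_inhabited_seventyTwo_of_modularity (hnf : exists_isNewformOf) :
    ∃ (W₀ : WeierstrassCurve ℚ) (_ : W₀.IsElliptic) (_ : W₀.IsGloballyMinimal) (D₀ : ModularParametrizationData W₀ 72),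
      (⟨0, 0, 0, 6, -7⟩ : WeierstrassCurve ℚ).IsIsogenous W₀ ∧ (∀ z ∈ D₀.L.lattice, ∃ w ∈ periodLattice D₀.f, z = D₀.c * w) ∧
      |D₀.maninConstant| = 1 := by
  haveI := isElliptic_seventyTwoA1
  haveI : NeZero (72 : ℕ) := ⟨by decide⟩
  obtain ⟨f, hf⟩ := exists_isNewformOf_seventyTwoA1 hnf
  obtain ⟨D⟩ := nonempty_modularParametrizationData_of_isNewformOf hf
  obtain ⟨W₀, h₀, hmin, D₀, -, hiso, hopt, -⟩ := ExistsMinimalOptimalDatum.existsMinimalOptimalDatum_full (⟨0, 0, 0, 6, -7⟩ : WeierstrassCurve ℚ) D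
  exact ⟨W₀, h₀, hmin, D₀, hiso, hopt, @abs_maninConstant_eq_one_seventyTwo W₀ h₀ hmin D₀ hopt⟩

/-- **C2's body at `N = 72` in the item's literal shape**: `2² ∣ 72 → 2 ∤ c(D)` for every datum with the lattice clause, and the domain is
inhabited GIVEN `exists_isNewformOf`. [cite: AgasheRibetStein2006, §§1–2] -/
theorem maninOddAtFour_seventyTwo (hnf : exists_isNewformOf) :
    (∃ (W₀ : WeierstrassCurve ℚ) (_ : W₀.IsElliptic) (_ : W₀.IsGloballyMinimal) (D₀ : ModularParametrizationData W₀ 72),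
        (∀ z ∈ D₀.L.lattice, ∃ w ∈ periodLattice D₀.f, z = D₀.c * w) ∧ |D₀.maninConstant| = 1) ∧
      ∀ (W : WeierstrassCurve ℚ) [W.IsElliptic] [W.IsGloballyMinimal] (D : ModularParametrizationData W 72),
        (∀ z ∈ D.L.lattice, ∃ w ∈ periodLattice D.f, z = D.c * w) → 2 ^ 2 ∣ 72 → ¬ (2 : ℤ) ∣ D.maninConstant := by
  refine ⟨?_, fun W _ _ D hopt _ ↦ not_two_dvd_maninConstant_seventyTwo W D hopt⟩
  obtain ⟨W₀, h₀, hmin, D₀, -, hopt, habs⟩ := domain_inhabited_seventyTwo_of_modularity hnf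
  exact ⟨W₀, h₀, hmin, D₀, hopt, habs⟩

/-- **C3's body at `N = 72` in the item's literal shape**: `3² ∣ 72 → 3 ∤ c(D)` for every datum with the lattice clause, and the domain is
inhabited GIVEN `exists_isNewformOf`. [cite: AgasheRibetStein2006, §§1–2] -/
theorem maninPrimeToThreeAtNine_seventyTwo (hnf : exists_isNewformOf) :
    (∃ (W₀ : WeierstrassCurve ℚ) (_ : W₀.IsElliptic) (_ : W₀.IsGloballyMinimal) (D₀ : ModularParametrizationData W₀ 72),
        (∀ z ∈ D₀.L.lattice, ∃ w ∈ periodLattice D₀.f, z = D₀.c * w) ∧ |D₀.maninConstant| = 1) ∧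
      ∀ (W : WeierstrassCurve ℚ) [W.IsElliptic] [W.IsGloballyMinimal] (D : ModularParametrizationData W 72),
        (∀ z ∈ D.L.lattice, ∃ w ∈ periodLattice D.f, z = D.c * w) → 3 ^ 2 ∣ 72 → ¬ (3 : ℤ) ∣ D.maninConstant := by
  refine ⟨?_, fun W _ _ D hopt _ ↦ not_three_dvd_maninConstant_seventyTwo W D hopt⟩
  obtain ⟨W₀, h₀, hmin, D₀, -, hopt, habs⟩ := domain_inhabited_seventyTwo_of_modularity hnf
  exact ⟨W₀, h₀, hmin, D₀, hopt, habs⟩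

end Summit.BirchSwinnertonDyer.BirchSwinnertonDyer.Theorems.ManinLocalTwoThree.ManinConstantSeventyTwo

end
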